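import Mathlib.RingTheory.Valuation.Basic
import Mathlib.Algebra.Order.BigOperators.GroupWithZero.Multiset
import Mathlib.Algebra.BigOperators.Field
import HarnessLib

/-!
# The conjugate-discs estimate: a bounded unit separating a disc from its conjugates

Topic: `Literature/AlgebraicGeometry/Resolution` (valued function fields; models of discs over
valuation rings). The ultrametric core of the "algebraization of a disc by `K`-rational functions"
in M. Temkin, *Inseparable local uniformization*, J. Algebra 373 (2013) = arXiv:0804.1554v3,
proof of Thm. 3.3.1, Step 3 (p. 45 of v3; p. 27 of the held arXiv version): "For any finite
Galois extension `F/l̂` with `m̂ ↪ F`, we have that `𝔙_{η,F} := 𝔙_η ⊗ F` is a disjoint union of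
unit `F`-discs … it is of the form `𝔊C_{η,F}{f₁, …, f_n}` … take `gⱼ ∈ 𝒜` to be the norm of
`fⱼ` … hence `𝔙_η = 𝔊C_η{g₁, …, g_n}`". In the algebraic proof the disc `|x − a| ≤ γ` around an
`m`-rational centre `a` is cut out, up to its conjugates, by the `k`-RATIONAL function
`Q(x) = ∏ᵢ (x − aᵢ)` (product over all conjugates `aᵢ` of `a = a_{i₀}`): the condition
`|Q(x)| ≤ γ^{#near} · ∏_{far} |aᵢ − a|` holds on the disc and on certain discs around the far
conjugates. This file proves the estimate that lets the `m`-RATIONAL function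

  `b(x) = ∏_{i far} (x − aᵢ)/(a − aᵢ)`

serve as a unit at the centre separating the disc from its conjugates: for EVERY valuation `w`
(of any rank — the estimate is used for all valuation rings containing a model, through
"integral = in every valuation overring") and every `x` satisfying the `Q`-bound,

* `valuation_conjProd_le_one` — `w(b(x)) ≤ 1`, and
* `valuation_conjProd_mul_sub_le` — `w(b(x)·(x − a)) ≤ γ`,

where near/far is measured by `w` itself (`w(aᵢ − a) ≤ γ` resp. `> γ`); and at points of the
disc (`w(x − a) ≤ γ`), `valuation_conjProd_eq_one_of_le` — `w(b(x)) = 1`. PROVED by a direct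
case analysis on `Δ = w(x − a)`: for `Δ ≤ γ` every far factor has value exactly `1`; for
`Δ > γ` the `Q`-bound forces `∏_{dᵢ = Δ} w(x − aᵢ)/Δ ≤ (γ/Δ)^{#near} ∏_{dᵢ < Δ} dᵢ/Δ`, which
cancels exactly against the factors with `dᵢ < Δ`. No hypothesis on the rank of `w`, on the
characteristic, or on separability is needed; all exponents are `1`.

All statements are [folklore] (ultrametric bookkeeping); no definitions of mathematical
content (`conjProd` is the explicit product `b`), no named facts.

## Sources

* M. Temkin, arXiv:0804.1554v3, proof of Thm. 3.3.1, Step 3 (the `K`-rational Weierstrass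
  domain and the norm trick), p. 45.
-/

open scoped BigOperators

namespace Literature.AlgebraicGeometry.Resolution

namespace ConjugateDiscs

variable {Ω : Type*} [Field Ω] {Γ₀ : Type*} [LinearOrderedCommGroupWithZero Γ₀]
  (w : Valuation Ω Γ₀) {I : Type*} [Fintype I] (a : I → Ω) (i₀ : I) (γ : Γ₀)

/-- The far conjugates (as seen by `w`): `w(aᵢ − a) > γ`. [folklore] -/
def far : Finset I := Finset.univ.filter fun i => γ < w (a i - a i₀)

/-- The near conjugates: `w(aᵢ − a) ≤ γ` (contains `i₀`). [folklore] -/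
def near : Finset I := Finset.univ.filter fun i => w (a i - a i₀) ≤ γ

/-- **The separating function** `b(x) = ∏_{i far} (x − aᵢ)/(a − aᵢ)`. [folklore] -/
def conjProd (x : Ω) : Ω := ∏ i ∈ far w a i₀ γ, (x - a i) / (a i₀ - a i)

/-- The `Q`-bound: `∏ᵢ w(x − aᵢ) ≤ γ^{#near} ∏_{far} w(aᵢ − a)`. [folklore] -/
def QBound (x : Ω) : Prop :=
  ∏ i, w (x - a i) ≤ γ ^ (near w a i₀ γ).card * ∏ i ∈ far w a i₀ γ, w (a i - a i₀)

variable {w a i₀ γ}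

/-- Membership in `far`. [folklore] -/
theorem mem_far {i : I} : i ∈ far w a i₀ γ ↔ γ < w (a i - a i₀) := by simp [far]

/-- Membership in `near`. [folklore] -/
theorem mem_near {i : I} : i ∈ near w a i₀ γ ↔ w (a i - a i₀) ≤ γ := by simp [near]

/-- The centre is near. [folklore] -/
theorem i₀_mem_near : i₀ ∈ near w a i₀ γ := by simp [near]

/-- There is at least one near conjugate. [folklore] -/
theorem near_card_pos : 0 < (near w a i₀ γ).card := Finset.card_pos.mpr ⟨i₀, i₀_mem_near⟩

omit [Fintype I] in
/-- In a linearly ordered group with zero, anything above something is nonzero. [folklore] -/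
theorem ne_zero_of_lt {b c : Γ₀} (h : b < c) : c ≠ 0 := by
  rintro rfl; exact not_lt_zero h

/-- Far conjugates differ from the centre. [folklore] -/
theorem far_ne_i₀ {i : I} (hi : i ∈ far w a i₀ γ) : a i₀ - a i ≠ 0 := by
  intro h0
  rw [mem_far, Valuation.map_sub_swap, h0, Valuation.map_zero] at hi
  exact not_lt_zero hi

/-- `univ = near ⊔ far` (disjointly). [folklore] -/
theorem prod_univ_eq (f : I → Γ₀) : ∏ i, f i = (∏ i ∈ near w a i₀ γ, f i) * ∏ i ∈ far w a i₀ γ, f i := by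
  classical
  rw [← Finset.prod_union]
  · congr 1
    ext i
    simp only [Finset.mem_univ, Finset.mem_union, mem_near, mem_far, true_iff]
    exact le_or_gt _ _
  · rw [Finset.disjoint_left]
    intro i h1 h2
    exact (not_lt.mpr (mem_near.mp h1)) (mem_far.mp h2)

/-! ### Values of the factors in terms of `Δ = w(x − a)` -/

section Factors

variable (x : Ω)

/-- Near factors: if `Δ > γ` then `w(x − aᵢ) = Δ` for near `i`. [folklore] -/
theorem valuation_sub_near_eq {i : I} (hi : i ∈ near w a i₀ γ) (hΔ : γ < w (x - a i₀)) :
    w (x - a i) = w (x - a i₀) := by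
  have h : x - a i = (x - a i₀) + (a i₀ - a i) := by ring
  rw [h]
  refine Valuation.map_add_eq_of_lt_left _ ?_
  rw [← neg_sub, Valuation.map_neg]
  exact lt_of_le_of_lt (mem_near.mp hi) hΔ

omit [Fintype I] in
/-- Far factors with `dᵢ > Δ`: `w(x − aᵢ) = dᵢ`. [folklore] -/
theorem valuation_sub_far_eq_of_lt {i : I} (hlt : w (x - a i₀) < w (a i - a i₀)) :
    w (x - a i) = w (a i - a i₀) := by
  have h : x - a i = (x - a i₀) - (a i - a i₀) := by ring
  rw [h]
  exact Valuation.map_sub_eq_of_lt_right _ hlt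

omit [Fintype I] in
/-- Far factors with `dᵢ < Δ`: `w(x − aᵢ) = Δ`. [folklore] -/
theorem valuation_sub_far_eq_of_gt {i : I} (hgt : w (a i - a i₀) < w (x - a i₀)) :
    w (x - a i) = w (x - a i₀) := by
  have h : x - a i = (x - a i₀) - (a i - a i₀) := by ring
  rw [h]
  exact Valuation.map_sub_eq_of_lt_left _ hgt

omit [Fintype I] in
/-- All factors: `w(x − aᵢ) ≤ max(Δ, dᵢ)`. [folklore] -/
theorem valuation_sub_le_max (i : I) : w (x - a i) ≤ max (w (x - a i₀)) (w (a i - a i₀)) := by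
  have h : x - a i = (x - a i₀) - (a i - a i₀) := by ring
  rw [h]
  exact Valuation.map_sub _ _ _

end Factors

/-! ### The estimate -/

/-- **On the disc** (`w(x − a) ≤ γ`) every far factor of `b` has value `1`: `w(b(x)) = 1`.
[folklore] -/
theorem valuation_conjProd_eq_one_of_le {x : Ω} (hΔ : w (x - a i₀) ≤ γ) : w (conjProd w a i₀ γ x) = 1 := by
  rw [conjProd, map_prod]
  refine Finset.prod_eq_one fun i hi => ?_
  have hfar := mem_far.mp hi
  rw [map_div₀, valuation_sub_far_eq_of_lt x (lt_of_le_of_lt hΔ hfar), Valuation.map_sub_swap w (a i₀) (a i),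
    div_self]
  exact ne_zero_of_lt hfar

/-- The far product at a general point: `∏_far w(x − aᵢ) = w(b(x)) · ∏_far dᵢ`. [folklore] -/
theorem prod_far_eq (x : Ω) : ∏ i ∈ far w a i₀ γ, w (x - a i) =
    w (conjProd w a i₀ γ x) * ∏ i ∈ far w a i₀ γ, w (a i - a i₀) := by
  rw [conjProd, map_prod, ← Finset.prod_mul_distrib]
  refine Finset.prod_congr rfl fun i hi => ?_
  rw [map_div₀, Valuation.map_sub_swap w (a i₀) (a i),
    div_mul_cancel₀ _ (ne_zero_of_lt (mem_far.mp hi))]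

/-- **The conjugate-discs estimate, I: `w(b(x)) ≤ 1`** under the `Q`-bound. [folklore] -/
theorem valuation_conjProd_le_one {x : Ω} (hQ : QBound w a i₀ γ x) :
    w (conjProd w a i₀ γ x) ≤ 1 := by
  rcases le_or_gt (w (x - a i₀)) γ with hΔ | hΔ
  · exact (valuation_conjProd_eq_one_of_le hΔ).le
  · -- `Δ > γ`: near factors are all `Δ`, so the bound reads `Δ^{#near} · b · ∏ d ≤ γ^{#near} · ∏ d`
    have hnear : ∏ i ∈ near w a i₀ γ, w (x - a i) = w (x - a i₀) ^ (near w a i₀ γ).card := by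
      rw [Finset.prod_eq_pow_card]
      intro i hi
      exact valuation_sub_near_eq x hi hΔ
    have hprod : (∏ i ∈ far w a i₀ γ, w (a i - a i₀)) ≠ 0 :=
      Finset.prod_ne_zero_iff.mpr fun i hi => ne_zero_of_lt (mem_far.mp hi)
    rw [QBound, prod_univ_eq (w := w) (a := a) (i₀ := i₀) (γ := γ), hnear, prod_far_eq, ← mul_assoc] at hQ
    have h1 : w (x - a i₀) ^ (near w a i₀ γ).card * w (conjProd w a i₀ γ x) ≤ γ ^ (near w a i₀ γ).card :=
      le_of_mul_le_mul_right hQ (zero_lt_iff.mpr hprod)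
    -- `γ^n < Δ^n`, hence `b ≤ γ^n / Δ^n ≤ 1`
    have hpow : γ ^ (near w a i₀ γ).card ≤ w (x - a i₀) ^ (near w a i₀ γ).card :=
      pow_le_pow_left' hΔ.le _
    have hΔ0 : w (x - a i₀) ^ (near w a i₀ γ).card ≠ 0 :=
      pow_ne_zero _ (ne_zero_of_lt hΔ)
    calc w (conjProd w a i₀ γ x)
        = (w (x - a i₀) ^ (near w a i₀ γ).card)⁻¹ *
            (w (x - a i₀) ^ (near w a i₀ γ).card * w (conjProd w a i₀ γ x)) := by
          rw [← mul_assoc, inv_mul_cancel₀ hΔ0, one_mul]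
      _ ≤ (w (x - a i₀) ^ (near w a i₀ γ).card)⁻¹ * γ ^ (near w a i₀ γ).card :=
          mul_le_mul' le_rfl h1
      _ ≤ (w (x - a i₀) ^ (near w a i₀ γ).card)⁻¹ * w (x - a i₀) ^ (near w a i₀ γ).card :=
          mul_le_mul' le_rfl hpow
      _ = 1 := inv_mul_cancel₀ hΔ0

/-- **The conjugate-discs estimate, II: `w(b(x)·(x − a)) ≤ γ`** under the `Q`-bound — the
function `b(x)·(x − a)/c` (`w(c) = γ`) is bounded by `1` wherever the `k`-rational function `Q`
is bounded as on the disc. [folklore] -/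
theorem valuation_conjProd_mul_sub_le {x : Ω} (hQ : QBound w a i₀ γ x) :
    w (conjProd w a i₀ γ x * (x - a i₀)) ≤ γ := by
  rw [map_mul]
  rcases le_or_gt (w (x - a i₀)) γ with hΔ | hΔ
  · rw [valuation_conjProd_eq_one_of_le hΔ, one_mul]; exact hΔ
  · have hnear : ∏ i ∈ near w a i₀ γ, w (x - a i) = w (x - a i₀) ^ (near w a i₀ γ).card := by
      rw [Finset.prod_eq_pow_card]
      intro i hi
      exact valuation_sub_near_eq x hi hΔ
    have hprod : (∏ i ∈ far w a i₀ γ, w (a i - a i₀)) ≠ 0 :=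
      Finset.prod_ne_zero_iff.mpr fun i hi => ne_zero_of_lt (mem_far.mp hi)
    have hQ' := hQ
    rw [QBound, prod_univ_eq (w := w) (a := a) (i₀ := i₀) (γ := γ), hnear, prod_far_eq, ← mul_assoc] at hQ'
    have h1 : w (x - a i₀) ^ (near w a i₀ γ).card * w (conjProd w a i₀ γ x) ≤ γ ^ (near w a i₀ γ).card :=
      le_of_mul_le_mul_right hQ' (zero_lt_iff.mpr hprod)
    -- write `n = n' + 1` and peel off one factor `Δ`
    obtain ⟨n', hn'⟩ : ∃ n', (near w a i₀ γ).card = n' + 1 := ⟨(near w a i₀ γ).card - 1, by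
      have := near_card_pos (w := w) (a := a) (i₀ := i₀) (γ := γ); omega⟩
    rw [hn', pow_succ, pow_succ] at h1
    have hΔ0 : w (x - a i₀) ≠ 0 := ne_zero_of_lt hΔ
    have hΔn0 : w (x - a i₀) ^ n' ≠ 0 := pow_ne_zero _ hΔ0
    have hpow : γ ^ n' ≤ w (x - a i₀) ^ n' := pow_le_pow_left' hΔ.le _
    -- `Δ^{n'} · (Δ · b) ≤ γ^{n'} · γ ≤ Δ^{n'} · γ`
    have h2 : w (x - a i₀) ^ n' * (w (conjProd w a i₀ γ x) * w (x - a i₀)) ≤ w (x - a i₀) ^ n' * γ := by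
      calc w (x - a i₀) ^ n' * (w (conjProd w a i₀ γ x) * w (x - a i₀))
          = w (x - a i₀) ^ n' * w (x - a i₀) * w (conjProd w a i₀ γ x) := by
            rw [mul_comm (w (conjProd w a i₀ γ x)) (w (x - a i₀)), ← mul_assoc]
        _ ≤ γ ^ n' * γ := h1
        _ ≤ w (x - a i₀) ^ n' * γ := mul_le_mul' hpow le_rfl
    have h3 := mul_le_mul' (le_refl (w (x - a i₀) ^ n')⁻¹) h2
    rwa [inv_mul_cancel_left₀ hΔn0, inv_mul_cancel_left₀ hΔn0] at h3

end ConjugateDiscs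

end Literature.AlgebraicGeometry.Resolution
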